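import Mathlib
import HarnessLib
import Summits.QuantumFields.YangMills.Theorems.HypercubicLimit.Negative.ReflectedDensity
import Summits.QuantumFields.YangMills.Theorems.FradkinShenkerFlowFiniteSusceptibilityWeakCouplingRPCauchySchwarz
import Summits.QuantumFields.YangMills.Theorems.LangevinControlUVOSLegsFromFemtoAndGapStubAssemblyLatticeDist
import Summits.QuantumFields.YangMills.Theorems.LangevinControlUVOSLegsFromFemtoAndGapStubAssemblyShiftDefect
import Literature.MathematicalPhysics.AQFT.OSAxiomsSchwinger
import Literature.MathematicalPhysics.QuantumFieldTheory.OSData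
import Literature.MathematicalPhysics.QuantumLattice.LatticeScalarField
import Literature.MathematicalPhysics.QuantumFieldTheory.LatticeGaugeStaticPotentialProofs
import Literature.Probability.LatticeModels.ThermodynamicLimit

/-!
# `HypercubicLimit`, line `conditional-mean-telescoping` (c1 blocks, wave 3): stub `rpBlock_planeExpansion`

Support file (`--supports stmt-QuantumFields-8646`) for crux
`Summit.QuantumFields.YangMills.Theses.PencilRigidity.HypercubicLimit`, line
`conditional-mean-telescoping`: the registered c1 block `rpBlock_planeExpansion` — **the plane
expansion of the curvature's lattice distribution**.

The sibling toolkit's `latticeDist ρ β L a O m n` (file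
`Theorems/LangevinControlUVOSLegsFromFemtoAndGapStubAssemblyLatticeDist.lean`) of the curvature species
`O = r.curvature.F` (the Wilson action density, i.e. the six plaquettes `Re tr ρ(U_p)` at a corner),
centred by `∑_q m_q`, is the sum over plaquette-orientation strings `q : Fin n → {(i, j) // i < j}` of
the centred plaquette-string torus moments `∫ ∏ₖ (p_{q k}(x k) − m_{q k}) dμ_β` paired with `F(a x)`.
This bridges the convergence clause of the crux (stated for `latticeDist`) and the c1 reflection /
gap blocks (stated for PLAQUETTE STRINGS `torusPlaquette`, file
`Theorems/HypercubicLimit/Negative/ReflectedDensity.lean`).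

Route (tree vocabulary only): `latticeDist_apply`; pointwise,
`r.curvature.F (configShift (-y) (torusLift L' U)) = torusDensity r L' y U = ∑_{i<j} p_{ij}(y)`
(`torusDensity_eq_sum`, re-indexed over the subtype of ordered pairs), so each centred factor is
`∑_q (p_q(x i) − m_q)` (`Finset.sum_sub_distrib`) and the product over `i` expands multilinearly
(`Fintype.prod_sum`); the finite sum is pulled out of the Wilson integral (`integral_finsetSum`,
each plaquette string being bounded by `(N + ∑_q |m_q|)ⁿ` and measurable), the real cast is pushed
through (`Complex.ofReal_sum`), `F(a x)` is distributed (`Finset.sum_mul`) and the two finite sums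
are swapped (`Finset.sum_comm`).
-/

noncomputable section

open scoped SchwartzMap ComplexConjugate
open MeasureTheory Filter Topology
open Literature.MathematicalPhysics.AQFT Literature.MathematicalPhysics.QuantumLattice
open Literature.MathematicalPhysics.QuantumFieldTheory
open Literature.Probability.LatticeModels (box Site)
open Summit.QuantumFields.YangMills.Theorems.HypercubicLimit.Negative (torusPlaquette thetaZ)
open Summit.QuantumFields.YangMills.Theorems.OSLegsFromFemtoAndGap (latticeDist torusMoment)

namespace Summit.QuantumFields.YangMills.Cruxes.HypercubicLimit.ConditionalMeanTelescoping

/-- Re-indexing: the double `ite` sum over plane orientations `(i, j)`, `i < j`, is the sum over the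
subtype of ordered pairs. [folklore] -/
theorem planeE_sum_ite_eq_sum_subtype (g : Fin 4 → Fin 4 → ℝ) :
    (∑ i : Fin 4, ∑ j : Fin 4, if i < j then g i j else 0) =
      ∑ q : {q : Fin 4 × Fin 4 // q.1 < q.2}, g q.1.1 q.1.2 := by
  rw [← Finset.sum_subtype (Finset.univ.filter fun q : Fin 4 × Fin 4 => q.1 < q.2) (by simp)
      (fun q : Fin 4 × Fin 4 => g q.1 q.2), Finset.sum_filter, Fintype.sum_prod_type]

/-- **The curvature species is the sum of its plaquettes, plane by plane.** At the corner `y ∈ ℤ⁴`,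
read on the torus of side `L'` through the periodic lift, `r.curvature.F` is the sum over ordered
planes `q = (i < j)` of the torus plaquettes `p_q(y)` (`torusDensity_eq_sum`). [folklore] -/
theorem planeE_curvature_eq_sum {G : Type} [Group G] [TopologicalSpace G] [IsTopologicalGroup G]
    [CompactSpace G] [MeasurableSpace G] [BorelSpace G] (r : LatticeRep G) (L' : ℕ) (y : Fin 4 → ℤ)
    (U : GaugeConfig 4 L' G) :
    r.curvature.F (configShift (-y) (torusLift L' U)) =
      ∑ q : {q : Fin 4 × Fin 4 // q.1 < q.2}, torusPlaquette r L' q.1.1 q.1.2 y U := by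
  exact (Summit.QuantumFields.YangMills.Theorems.HypercubicLimit.Negative.torusDensity_eq_sum r L' y U).trans
    (planeE_sum_ite_eq_sum_subtype fun i j => torusPlaquette r L' i j y U)

/-- **Centred multilinear expansion of the curvature string.** The product over the arguments of the
curvature species centred by `∑_q m_q` is the sum over orientation strings `Q` of the centred plaquette
strings `∏ₖ (p_{Q k}(x k) − m_{Q k})` (`Finset.sum_sub_distrib` + `Fintype.prod_sum`). [folklore] -/
theorem planeE_prod_centred_eq_sum {G : Type} [Group G] [TopologicalSpace G] [IsTopologicalGroup G]
    [CompactSpace G] [MeasurableSpace G] [BorelSpace G] (r : LatticeRep G) (L' : ℕ)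
    (m : {q : Fin 4 × Fin 4 // q.1 < q.2} → ℝ) {n : ℕ} (x : Fin n → (Fin 4 → ℤ))
    (U : GaugeConfig 4 L' G) :
    ∏ i, (r.curvature.F (configShift (-(x i)) (torusLift L' U)) -
        ∑ q : {q : Fin 4 × Fin 4 // q.1 < q.2}, m q) =
      ∑ Q : Fin n → {q : Fin 4 × Fin 4 // q.1 < q.2},
        ∏ k, (torusPlaquette r L' (Q k).1.1 (Q k).1.2 (x k) U - m (Q k)) := by
  have h : ∀ i, r.curvature.F (configShift (-(x i)) (torusLift L' U)) -
      ∑ q : {q : Fin 4 × Fin 4 // q.1 < q.2}, m q =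
        ∑ q : {q : Fin 4 × Fin 4 // q.1 < q.2}, (torusPlaquette r L' q.1.1 q.1.2 (x i) U - m q) :=
    fun i => by rw [planeE_curvature_eq_sum, Finset.sum_sub_distrib]
  simp_rw [h]
  exact Fintype.prod_sum
    (fun (i : Fin n) (q : {q : Fin 4 × Fin 4 // q.1 < q.2}) => torusPlaquette r L' q.1.1 q.1.2 (x i) U - m q)

/-- **A centred plaquette string is Wilson-integrable** on the odd torus: it is measurable
(`measurable_torusPlaquette`) and bounded by `(N + ∑_q |m_q|)ⁿ` (`|Re tr ρ(U_p)| ≤ N`,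
`abs_plaquetteObs_le_holds`), and Wilson's torus measure is a probability measure. [folklore] -/
theorem planeE_integrable_string {G : Type} [Group G] [TopologicalSpace G] [IsTopologicalGroup G]
    [CompactSpace G] [MeasurableSpace G] [BorelSpace G] (r : LatticeRep G) (β : ℝ) (L : ℕ) {n : ℕ}
    (Q : Fin n → {q : Fin 4 × Fin 4 // q.1 < q.2}) (m : {q : Fin 4 × Fin 4 // q.1 < q.2} → ℝ)
    (x : Fin n → (Fin 4 → ℤ)) :
    Integrable (fun U : GaugeConfig 4 (2 * L + 1) G =>
        ∏ k, (torusPlaquette r (2 * L + 1) (Q k).1.1 (Q k).1.2 (x k) U - m (Q k)))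
      (wilsonMeasure (d := 4) (L := 2 * L + 1) r.ρ β) := by
  haveI : NeZero (2 * L + 1) := ⟨by omega⟩
  haveI := isProbabilityMeasure_wilsonMeasure (d := 4) (L := 2 * L + 1) r.ρ r.continuous β
  have hmeas : Measurable fun U : GaugeConfig 4 (2 * L + 1) G =>
      ∏ k, (torusPlaquette r (2 * L + 1) (Q k).1.1 (Q k).1.2 (x k) U - m (Q k)) :=
    Finset.measurable_prod _ fun k _ =>
      (Summit.QuantumFields.YangMills.Theorems.HypercubicLimit.Negative.measurable_torusPlaquette
        r (2 * L + 1) (Q k).1.1 (Q k).1.2 (x k)).sub measurable_const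
  refine Integrable.of_bound (C := ((r.N : ℝ) + ∑ q, |m q|) ^ n) hmeas.aestronglyMeasurable ?_
  refine Eventually.of_forall fun U => ?_
  rw [Real.norm_eq_abs, Finset.abs_prod]
  calc ∏ k, |torusPlaquette r (2 * L + 1) (Q k).1.1 (Q k).1.2 (x k) U - m (Q k)|
      ≤ ∏ _k : Fin n, ((r.N : ℝ) + ∑ q, |m q|) :=
        Finset.prod_le_prod (fun _ _ => abs_nonneg _) fun k _ =>
          (abs_sub _ _).trans (add_le_add
            (abs_plaquetteObs_le_holds (ρ := r.ρ) r.mem_unitary (x k) (Q k).1.1 (Q k).1.2 _)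
            (Finset.single_le_sum (f := fun q => |m q|) (fun _ _ => abs_nonneg _)
              (Finset.mem_univ (Q k))))
    _ = ((r.N : ℝ) + ∑ q, |m q|) ^ n := by simp

/-- **The plaquette-string expansion of the curvature's torus moment.** The toolkit's centred torus
moment of the curvature species, centred by `∑_q m_q`, is the sum over orientation strings of the
centred plaquette-string Wilson moments. [folklore] -/
theorem planeE_torusMoment_eq_sum {G : Type} [Group G] [TopologicalSpace G] [IsTopologicalGroup G]
    [CompactSpace G] [MeasurableSpace G] [BorelSpace G] (r : LatticeRep G) (β : ℝ) (L : ℕ)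
    (m : {q : Fin 4 × Fin 4 // q.1 < q.2} → ℝ) {n : ℕ} (x : Fin n → (Fin 4 → ℤ)) :
    torusMoment r.ρ β L r.curvature.F (∑ q : {q : Fin 4 × Fin 4 // q.1 < q.2}, m q) x =
      ∑ Q : Fin n → {q : Fin 4 × Fin 4 // q.1 < q.2},
        ∫ U, ∏ k, (torusPlaquette r (2 * L + 1) (Q k).1.1 (Q k).1.2 (x k) U - m (Q k))
          ∂(wilsonMeasure r.ρ β : Measure (GaugeConfig 4 (2 * L + 1) G)) := by
  unfold Summit.QuantumFields.YangMills.Theorems.OSLegsFromFemtoAndGap.torusMoment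
  simp_rw [planeE_prod_centred_eq_sum r (2 * L + 1) m x]
  exact integral_finsetSum _ fun Q _ => planeE_integrable_string r β L Q m x

/-- **Block PLANE (plane expansion of the curvature's lattice distribution).** The sibling toolkit's
`latticeDist` of the curvature species `r.curvature.F` (= the six plaquettes at a corner), centred by
`∑_q m_q`, is the sum over orientation strings `q` of the centred plaquette-string torus moments paired
with `F(a x)` (`torusDensity_eq_sum` + multilinear expansion `Finset.prod_univ_sum`). [folklore] -/
theorem rpBlock_planeExpansion :
    ∀ (G : Type) [Group G] [TopologicalSpace G] [IsTopologicalGroup G] [CompactSpace G]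
      [MeasurableSpace G] [BorelSpace G] (r : LatticeRep G) (β : ℝ) (L : ℕ) (a : ℝ)
      (m : {q : Fin 4 × Fin 4 // q.1 < q.2} → ℝ) (n : ℕ)
      (F : 𝓢((Fin n → EuclideanSpace ℝ (Fin 4)), ℂ)),
      latticeDist r.ρ β L a r.curvature.F (∑ q : {q : Fin 4 × Fin 4 // q.1 < q.2}, m q) n F =
        ∑ q : Fin n → {q : Fin 4 × Fin 4 // q.1 < q.2},
          ∑ x ∈ Fintype.piFinset (fun _ : Fin n => box 4 L),
            (((∫ U, ∏ k, (torusPlaquette r (2 * L + 1) (q k).1.1 (q k).1.2 (x k) U - m (q k))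
                ∂(wilsonMeasure r.ρ β : Measure (GaugeConfig 4 (2 * L + 1) G)) : ℝ) : ℂ)) *
              F (fun k => a • siteToE (x k)) := by
  intro G _ _ _ _ _ _ r β L a m n F
  rw [Summit.QuantumFields.YangMills.Theorems.OSLegsFromFemtoAndGap.latticeDist_apply,
    Finset.sum_comm]
  refine Finset.sum_congr rfl fun x _ => ?_
  rw [← Finset.sum_mul, ← Complex.ofReal_sum, planeE_torusMoment_eq_sum r β L m x]

end Summit.QuantumFields.YangMills.Cruxes.HypercubicLimit.ConditionalMeanTelescoping

end
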